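import Mathlib.Analysis.SpecialFunctions.Integrals.Basic
import Literature.NumberTheory.Transcendental.KZLogCalculusProofs
import Literature.NumberTheory.Transcendental.KZDominatedFamilyRelations
import Literature.NumberTheory.Transcendental.KZSemialgebraicComplex
import Literature.NumberTheory.Transcendental.EllIterRep
import Summits.KontsevichZagierPeriods.KontsevichZagierPeriods.Theorems.TerasomaMultiplicationBetaCancellationStubAffineMove
import Summits.KontsevichZagierPeriods.KontsevichZagierPeriods.Theorems.NormalFormPrinciple.Negative.WindowInvariant

/-!
# `NormalFormPrinciple` (stmt-KontsevichZagierPeriods-3869), line `SketchIdeator1` — the leaf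
# `stub_boxRigidity` in dimension one, IX: dlog representations with real ALGEBRAIC data

Pure proof file (lead seat c3; `--supports` the crux). The dlog representations and their moves of
`…DlogMoves.lean` with the rational data `a, b, c, s` replaced by real ALGEBRAIC numbers (Kontsevich–
Zagier allow algebraic coefficients: a real algebraic constant is a `ℚ`-semialgebraic function,
`isSemialgebraicFunOn_const_of_isAlgebraic`) — the carriers of the algebraic-pole layer of the leaf:

* `exists_dlogA`, `value_dlogA` (`[(a,b), c/y]`, value `c log(b/a)`);
* congruence / zero / empty / merging (rule 1) and **scaling** by an algebraic `s > 0` (rule 2,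
  `dlogA_scale_mem_relations`, registered sub-goal);
* splitting and empty slabs are `split_mem_relations` / `slab_empty_mem_relations` of `…DlogMoves.lean`
  (real endpoints already), not repeated here.

Sources: M. Kontsevich, D. Zagier, *Periods* (2001), §1.1–1.2. No definitions are introduced.
-/

noncomputable section

open MeasureTheory Set Finset
open Literature.NumberTheory.Transcendental Literature.NumberTheory.Transcendental.KZ
open Literature.ModelTheory.ExponentialFields (IsSemialgebraic)

namespace Summit.KontsevichZagierPeriods.HurwitzMicroSectors.NormalFormPrinciple.PiBox

namespace Dlog

open Summit.KontsevichZagierPeriods.KontsevichZagierPeriods.BetaCancellationLine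
  (aff_hasFDerivAt_chart aff_abs_det_chartDeriv aff_injective_chart aff_isSemialgebraicMapOn_chart)
open Summit.KontsevichZagierPeriods.HurwitzMicroSectors.NormalFormPrinciple.Negative
  (setIntegral_fin_one integrableOn_fin_one)
open Summit.KontsevichZagierPeriods.KontsevichZagierPeriods.BetaCancellationNegative
  (volume_setOf_apply_eq_zero)

/-! ## Coordinate slabs with algebraic ends -/

/-- `{x | a < x i < b} ⊂ ℝⁿ` is `ℚ`-semialgebraic for real algebraic `a`, `b` and any coordinate `i`.
[cite: BochnakCosteRoy1998, §2.1] -/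
theorem isSemialgebraic_setOf_apply_mem_Ioo_of_isAlgebraic {n : ℕ} {a b : ℝ} (ha : IsAlgebraic ℚ a)
    (hb : IsAlgebraic ℚ b) (i : Fin n) : IsSemialgebraic ℚ {x : Fin n → ℝ | x i ∈ Set.Ioo a b} := by
  have h : {x : Fin n → ℝ | x i ∈ Set.Ioo a b} = {x : Fin n → ℝ | a < x i} ∩ {x | x i < b} := by
    ext x; simp
  rw [h]
  exact (isSemialgebraic_setOf_const_lt_apply ha i).inter (isSemialgebraic_setOf_apply_lt_const hb i)

/-! ## The dlog representations with algebraic data -/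

/-- **Existence**: `[(a,b), c/y]` for real algebraic `a, b, c` with `0 < a`.
[cite: KontsevichZagier2001, §1.1] -/
theorem exists_dlogA {a b c : ℝ} (ha : IsAlgebraic ℚ a) (hb : IsAlgebraic ℚ b)
    (hc : IsAlgebraic ℚ c) (ha0 : 0 < a) :
    ∃ L : IntegralRep 1, L.domain = {x | x 0 ∈ Set.Ioo a b} ∧ L.integrand = fun x => c / x 0 := by
  have hdom := isSemialgebraic_setOf_apply_mem_Ioo_of_isAlgebraic ha hb (0 : Fin 1)
  have hpos : ∀ x ∈ {x : Fin 1 → ℝ | x 0 ∈ Set.Ioo a b}, 0 < x 0 := fun x hx => lt_trans ha0 hx.1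
  have hinv : IsSemialgebraicFunOn ℚ {x : Fin 1 → ℝ | x 0 ∈ Set.Ioo a b} (fun x => 1 / x 0) := by
    refine (isSemialgebraicFunOn_aeval_div_aeval hdom (1 : MvPolynomial (Fin 1) ℚ)
      (MvPolynomial.X 0) fun x hx => ?_).congr fun x _ => ?_
    · simp only [MvPolynomial.aeval_X]; exact (hpos x hx).ne'
    · simp
  have hsa : IsSemialgebraicFunOn ℚ {x : Fin 1 → ℝ | x 0 ∈ Set.Ioo a b} (fun x => c / x 0) :=
    (IsSemialgebraicFunOn.mul_holds (isSemialgebraicFunOn_const_of_isAlgebraic hdom hc) hinv).congr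
      fun x _ => by rw [Pi.mul_apply]; ring
  have hint : IntegrableOn (fun x : Fin 1 → ℝ => c / x 0) {x : Fin 1 → ℝ | x 0 ∈ Set.Ioo a b} := by
    rw [integrableOn_fin_one]
    have hcont : ContinuousOn (fun t : ℝ => c / t) (Set.Icc a b) :=
      continuousOn_const.div continuousOn_id fun t ht => (lt_of_lt_of_le ha0 ht.1).ne'
    exact (hcont.integrableOn_compact isCompact_Icc).mono_set Set.Ioo_subset_Icc_self
  exact ⟨⟨_, _, hdom, hsa, hint⟩, rfl, rfl⟩

/-- **Value**: `∫_{(a,b)} c/y dy = c log(b/a)` for `0 < a ≤ b`. [cite: KontsevichZagier2001, §1.1] -/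
theorem value_dlogA {a b c : ℝ} (L : IntegralRep 1) (hd : L.domain = {x | x 0 ∈ Set.Ioo a b})
    (hi : EqOn L.integrand (fun x => c / x 0) L.domain) (ha0 : 0 < a) (hab : a ≤ b) :
    L.value = c * Real.log (b / a) := by
  rw [IntegralRep.value, setIntegral_congr_fun (IsSemialgebraic.measurableSet_holds
    L.isSemialgebraic_domain) hi, hd, setIntegral_fin_one (fun x => c / x 0) (Set.Ioo a b)]
  simp only
  rw [← integral_Ioc_eq_integral_Ioo, ← intervalIntegral.integral_of_le hab]
  have : (fun t : ℝ => c / t) = fun t => c * t⁻¹ := by funext t; rw [div_eq_mul_inv]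
  rw [this, intervalIntegral.integral_const_mul, integral_inv_of_pos ha0 (lt_of_lt_of_le ha0 hab)]

/-! ## The moves -/

/-- Congruence of two representations on one slab with integrands `c/y`. [cite: KontsevichZagier2001, §1.2] -/
theorem dlogA_congr_mem_relations {σ : Set (Fin 1 → ℝ)} {c : ℝ} (L L' : IntegralRep 1)
    (hd : L.domain = σ) (hd' : L'.domain = σ) (hi : EqOn L.integrand (fun x => c / x 0) L.domain)
    (hi' : EqOn L'.integrand (fun x => c / x 0) L'.domain) : of L - of L' ∈ relations :=
  of_sub_of_mem_relations_of_eqOn (hd'.trans hd.symm) fun x hx => by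
    rw [hi hx, hi' (by rw [hd', ← hd]; exact hx)]

/-- Zero constant: `[σ, 0/y] ∈ relations`. [cite: KontsevichZagier2001, §1.2] -/
theorem dlogA_zero_mem_relations (L : IntegralRep 1)
    (hi : EqOn L.integrand (fun x => (0:ℝ) / x 0) L.domain) : of L ∈ relations :=
  of_mem_relations_of_eqOn_zero L fun x hx => by simp [hi hx]

/-- Merging (rule 1b): `[σ, (c+c')/y] − [σ, c/y] − [σ, c'/y] ∈ relations`.
[cite: KontsevichZagier2001, §1.2 rule (1)] -/
theorem dlogA_merge_mem_relations {σ : Set (Fin 1 → ℝ)} {c c' : ℝ} (L L₁ L₂ : IntegralRep 1)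
    (hd : L.domain = σ) (hd₁ : L₁.domain = σ) (hd₂ : L₂.domain = σ)
    (hi : EqOn L.integrand (fun x => (c + c') / x 0) L.domain)
    (hi₁ : EqOn L₁.integrand (fun x => c / x 0) L₁.domain)
    (hi₂ : EqOn L₂.integrand (fun x => c' / x 0) L₂.domain) :
    of L - of L₁ - of L₂ ∈ relations := by
  refine integrandAddRel_subset_relations ⟨1, L, L₁, L₂, hd₁.trans hd.symm, hd₂.trans hd.symm,
    fun x hx => ?_, rfl⟩
  rw [Pi.add_apply, hi hx, hi₁ (by rw [hd₁, ← hd]; exact hx), hi₂ (by rw [hd₂, ← hd]; exact hx)]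
  ring

/-- **Scaling by an algebraic factor** (rule 2): for real algebraic `s > 0` and `0 < a`,
`[(a,b), c/y] − [(sa, sb), c/y] ∈ relations` (dilation `y ↦ s y`, Jacobian `s`,
`c/y = (c/(sy))·s`). [cite: KontsevichZagier2001, §1.2 rule (2)] -/
theorem dlogA_scale_mem_relations {a b c s : ℝ} (hs : IsAlgebraic ℚ s) (L L' : IntegralRep 1)
    (hd : L.domain = {x | x 0 ∈ Set.Ioo a b})
    (hd' : L'.domain = {x | x 0 ∈ Set.Ioo (s * a) (s * b)})
    (hi : EqOn L.integrand (fun x => c / x 0) L.domain)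
    (hi' : EqOn L'.integrand (fun x => c / x 0) L'.domain) (ha0 : 0 < a) (hs0 : 0 < s) :
    of L - of L' ∈ relations := by
  have himage : L'.domain = (fun y : Fin 1 → ℝ => fun _ : Fin 1 => s * y 0 + 0) '' L.domain := by
    rw [hd, hd']
    ext y
    constructor
    · intro hy
      simp only [Set.mem_setOf_eq, Set.mem_Ioo] at hy
      refine ⟨fun _ => y 0 / s, ?_, ?_⟩
      · simp only [Set.mem_setOf_eq, Set.mem_Ioo]
        rw [lt_div_iff₀ hs0, div_lt_iff₀ hs0]
        constructor <;> nlinarith [hy.1, hy.2]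
      · funext i
        obtain rfl : i = 0 := Fin.fin_one_eq_zero i
        field_simp
        ring
    · rintro ⟨x, hx, rfl⟩
      simp only [Set.mem_setOf_eq, Set.mem_Ioo, add_zero] at hx ⊢
      exact ⟨mul_lt_mul_of_pos_left hx.1 hs0, mul_lt_mul_of_pos_left hx.2 hs0⟩
  refine changeOfVariablesRel_subset_relations
    ⟨1, L, L', fun y : Fin 1 → ℝ => fun _ : Fin 1 => s * y 0 + 0,
      fun _ => s • ContinuousLinearMap.id ℝ (Fin 1 → ℝ),
      aff_isSemialgebraicMapOn_chart L.isSemialgebraic_domain isAlgebraic_zero hs,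
      fun x _ => (aff_hasFDerivAt_chart s 0 x).hasFDerivWithinAt,
      (aff_injective_chart hs0.ne' 0).injOn, himage, fun x hx => ?_, rfl⟩
  have hΦx : (fun _ : Fin 1 => s * x 0 + 0) ∈ L'.domain := himage ▸ Set.mem_image_of_mem _ hx
  have hx0 : (0:ℝ) < x 0 := by rw [hd] at hx; exact lt_trans ha0 hx.1
  rw [hi hx, hi' hΦx, aff_abs_det_chartDeriv hs0]
  simp only [add_zero]
  field_simp

end Dlog

end Summit.KontsevichZagierPeriods.HurwitzMicroSectors.NormalFormPrinciple.PiBox
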